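import Literature.RingTheory.FormalGroups.BudCocycle
import HarnessLib

/-!
# Lazard's bud lemma, II: the obstruction is a multiple of `C_n` (Lazard's Prop. 2)
# ([Lazard 1955] §I Prop. 2, Lemme 3; §III (3.5)–(3.8))

Topic `Literature/RingTheory/FormalGroups`; namespace `Literature.RingTheory.FormalGroups`.  THEOREMS ONLY; no definition,
no named fact, no instance, no `sorry`.  Sequel of `BudCocycle.lean`: with `Δ = ψ(G(X,Y)) - H(ψX,ψY) ≡ 0 (mod deg n)`
(`n ≥ 1`) and `γ_s = [X^sY^{n-s}]Δ`,

* `budCocycle_coeff_rel` — the coefficient of `x^i y^j z^l` (`i+j+l = n`) in `δΓ = 0`: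
  `[l=0]γ_i + C(i+j,i)γ_{i+j} = [i=0]γ_j + C(n-i,j)γ_i` (Lazard (3.5)–(3.6)); hence `budCocycle_rel`
  (`C(s,i)γ_s = C(n-i,s-i)γ_i`), `budCocycle_zero`, `budCocycle_top` (`γ_0 = γ_n = 0`);
* `budCocycle_symm` — `γ_{n-s} = γ_s` when `G` and `H` are commutative;
* `exists_le_order_bud_sub_lazardPoly` — **Lazard's Prop. 2 over a ring with `p` nilpotent**: `Δ ≡ c · C_n (mod deg n+1)` for
  some `c`, by the comparison lemma `exists_eq_lazardCoeff_mul_of_isNilpotent`.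

The series `Δ` is passed as a variable with its defining equation `hΔeq` (to keep statements readable).

## References
* [Lazard1955] M. Lazard, Bull. SMF 83 (1955), §I Prop. 2 (p. 257), §III (3.4)–(3.8).
-/

noncomputable section

namespace Literature.RingTheory.FormalGroups

open MvPowerSeries Finset Finsupp

variable {B : Type*} [CommRing B]

section Obstruction

variable (G H : FormalGroup B) {ψ : PowerSeries B} (hψ0 : PowerSeries.constantCoeff ψ = 0) {n : ℕ}
  {Δ : MvPowerSeries (Fin 2) B}
  (hΔeq : Δ = PowerSeries.subst G.toPowerSeries ψ -
    H.toPowerSeries.subst ![PowerSeries.subst (X 0 : MvPowerSeries (Fin 2) B) ψ, PowerSeries.subst (X 1) ψ])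

include hψ0 hΔeq in
/-- **The cocycle relations on the coefficients of the obstruction** (coefficient of `x^i y^j z^l`, `i+j+l = n`, in `δΓ = 0`):
`[l=0]·γ_i + C(i+j,i)·γ_{i+j} = [i=0]·γ_j + C(n-i,j)·γ_i`. [cite: Lazard1955, §III (3.5)–(3.6)] -/
theorem budCocycle_coeff_rel (hn : 1 ≤ n) (hΔ : (n : ℕ∞) ≤ Δ.order) {i j l : ℕ} (h : i + j + l = n) :
    (if l = 0 then coeff (single 0 i + single 1 (n - i)) Δ else 0) +
        ((i + j).choose i : B) * coeff (single 0 (i + j) + single 1 (n - (i + j))) Δ =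
      (if i = 0 then coeff (single 0 j + single 1 (n - j)) Δ else 0) +
        ((n - i).choose j : B) * coeff (single 0 i + single 1 (n - i)) Δ := by
  subst hΔeq
  have key := (natCast_le_order_sub_iff.mp (le_order_budCocycle G H hψ0 hn hΔ)) (single 0 i + single 1 j + single 2 l)
    (by rw [map_add, map_add, degree_single, degree_single, degree_single]; omega)
  rw [map_add, map_add, coeff_homog_subst_01 _ h, coeff_homog_subst_add_2 _ h, coeff_homog_subst_12 _ h,
    coeff_homog_subst_0_add _ h] at key
  exact key

include hψ0 hΔeq in
/-- Lazard's relations (3.6): `C(s,i) γ_s = C(n-i,s-i) γ_i` for `1 ≤ i ≤ s ≤ n-1`. [cite: Lazard1955, §III (3.6)] -/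
theorem budCocycle_rel (hn : 1 ≤ n) (hΔ : (n : ℕ∞) ≤ Δ.order) {i s : ℕ} (hi : 1 ≤ i) (his : i ≤ s) (hs : s ≤ n - 1) :
    (s.choose i : B) * coeff (single 0 s + single 1 (n - s)) Δ =
      ((n - i).choose (s - i) : B) * coeff (single 0 i + single 1 (n - i)) Δ := by
  have key := budCocycle_coeff_rel G H hψ0 hΔeq hn hΔ (i := i) (j := s - i) (l := n - s) (by omega)
  rw [if_neg (by omega), if_neg (by omega), zero_add, zero_add, show i + (s - i) = s by omega] at key
  exact key

include hψ0 hΔeq in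
/-- `γ_0 = 0` (the relation at `x^0 y^0 z^n`). [cite: Lazard1955, §III (3.5)] -/
theorem budCocycle_zero (hn : 1 ≤ n) (hΔ : (n : ℕ∞) ≤ Δ.order) : coeff (single 0 0 + single 1 (n - 0)) Δ = 0 := by
  have key := budCocycle_coeff_rel G H hψ0 hΔeq hn hΔ (i := 0) (j := 0) (l := n) (by omega)
  simp only [if_neg (show ¬ n = 0 by omega), zero_add, Nat.choose_zero_right, Nat.cast_one, one_mul, ite_true] at key
  linear_combination -key

include hψ0 hΔeq in
/-- `γ_n = 0` (the relation at `x^n y^0 z^0`). [cite: Lazard1955, §III (3.5)] -/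
theorem budCocycle_top (hn : 1 ≤ n) (hΔ : (n : ℕ∞) ≤ Δ.order) : coeff (single 0 n + single 1 (n - n)) Δ = 0 := by
  have key := budCocycle_coeff_rel G H hψ0 hΔeq hn hΔ (i := n) (j := 0) (l := 0) (by omega)
  simp only [ite_true, if_neg (show ¬ n = 0 by omega), add_zero, zero_add, Nat.choose_self, Nat.sub_self,
    Nat.cast_one, one_mul] at key
  rw [Nat.sub_self]
  linear_combination key

include hψ0 hΔeq in
/-- **Symmetry of the obstruction**: `γ_{n-s} = γ_s` when `G` and `H` are commutative (`Δ(Y,X) = Δ(X,Y)`).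
[cite: Lazard1955, §III (3.4)] -/
theorem budCocycle_symm [G.IsComm] [H.IsComm] (hΔ : (n : ℕ∞) ≤ Δ.order) {s : ℕ} (hs : s ≤ n) :
    coeff (single 0 (n - s) + single 1 (n - (n - s))) Δ = coeff (single 0 s + single 1 (n - s)) Δ := by
  set γ : ℕ → B := fun s => coeff (single 0 s + single 1 (n - s)) Δ with hγ
  have h10 : ∀ i, constantCoeff ((![X 1, X 0] : Fin 2 → MvPowerSeries (Fin 2) B) i) = 0 := by
    intro i; fin_cases i <;> simp
  have hψX : ∀ i : Fin 2, PowerSeries.HasSubst (PowerSeries.subst (X i : MvPowerSeries (Fin 2) B) ψ) :=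
    fun i => PowerSeries.HasSubst.of_constantCoeff_zero (PowerSeries.constantCoeff_subst_eq_zero (constantCoeff_X i) ψ hψ0)
  -- `Δ(X₁,X₀) = Δ`
  have hswap : subst ![X 1, X 0] Δ = Δ := by
    rw [hΔeq, subst_sub HasSubst.X_X, subst_powerSeries_subst (hasSubst_formalGroup G) HasSubst.X_X,
      subst_formalGroup_psubst H hψ0 h10]
    simp only [Matrix.cons_val_zero, Matrix.cons_val_one]
    rw [← H.comm' (hψX 0) (hψX 1)]
    have hG : G.toPowerSeries.subst ![X 1, X 0] = G.toPowerSeries := (FormalGroup.IsComm.comm (F := G)).symm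
    rw [hG]
  -- `Γ ≡ Γ(X₁,X₀) (mod deg n+1)`
  have hΔΓ := le_order_sub_homog (n := n) hΔ
  have h1 : ((n + 1 : ℕ) : ℕ∞) ≤ (Δ - ∑ t ∈ range (n + 1), γ t • ((X 1 : MvPowerSeries (Fin 2) B) ^ t * (X 0) ^ (n - t))).order := by
    have h := le_order_subst_of_le_order hΔΓ h10
    rw [subst_sub HasSubst.X_X, hswap, subst_homog γ n HasSubst.X_X] at h
    simpa using h
  have h2 := natCast_le_order_sub_trans (natCast_le_order_sub_comm hΔΓ) h1
  have key := (natCast_le_order_sub_iff.mp h2) (single 0 s + single 1 (n - s))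
    (by rw [map_add, degree_single, degree_single]; omega)
  rw [coeff_homog_swap γ hs, coeff_homog γ hs] at key
  exact key.symm

include hψ0 hΔeq in
/-- **Lazard's Prop. 2 (over a ring with `p` nilpotent): the obstruction is a multiple of `C_n`.**  If `G`, `H` are
commutative, `Δ = ψ(G(X,Y)) - H(ψX,ψY) ≡ 0 (mod deg n)` with `n ≥ 2`, and `p` is nilpotent in `B`, then
`Δ ≡ c · C_n(X,Y) (mod deg n+1)` for some `c ∈ B`. [cite: Lazard1955, §I Prop. 2] -/
theorem exists_le_order_bud_sub_lazardPoly [G.IsComm] [H.IsComm] (p : ℕ) [Fact p.Prime] (hpB : IsNilpotent (p : B))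
    (hn : 2 ≤ n) (hΔ : (n : ℕ∞) ≤ Δ.order) :
    ∃ c : B, ((n + 1 : ℕ) : ℕ∞) ≤ (Δ - C c * lazardPoly B n).order := by
  set γ : ℕ → B := fun s => coeff (single 0 s + single 1 (n - s)) Δ with hγ
  obtain ⟨c, hc⟩ := exists_eq_lazardCoeff_mul_of_isNilpotent (p := p) hpB hn (a := γ)
    (fun s _ hs2 => budCocycle_symm G H hψ0 hΔeq hΔ (by omega))
    (fun i s hi his hs => budCocycle_rel G H hψ0 hΔeq (by omega) hΔ hi his hs)
  refine ⟨c, natCast_le_order_sub_iff.mpr fun d hd => ?_⟩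
  rw [fin2_eq_single_add_single d] at hd ⊢
  rw [map_add, degree_single, degree_single] at hd
  rw [coeff_C_mul]
  by_cases hdn : d 0 + d 1 = n
  · rw [show d 1 = n - d 0 by omega, coeff_lazardPoly]
    split_ifs with h
    · rw [mul_comm]; exact hc (d 0) h.1 (by omega)
    · rw [mul_zero]
      rcases Nat.eq_zero_or_pos (d 0) with h0 | h0
      · rw [h0]; exact budCocycle_zero G H hψ0 hΔeq (by omega) hΔ
      · have : d 0 = n := by omega
        rw [this]; exact budCocycle_top G H hψ0 hΔeq (by omega) hΔ
  · have hlt : d 0 + d 1 < n := by omega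
    rw [(natCast_le_order_iff.mp hΔ) _ (by rw [map_add, degree_single, degree_single]; exact hlt),
      (natCast_le_order_iff.mp (le_order_lazardPoly (R := B) n)) _ (by rw [map_add, degree_single, degree_single]; exact hlt),
      mul_zero]

end Obstruction

end Literature.RingTheory.FormalGroups
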